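import Summits.HodgeConjecture.HodgeConjecture.Theses.LinearSystemTorelli
import Literature.AlgebraicGeometry.HodgeTheory.HodgeRiemannPolarizability
import Literature.AlgebraicGeometry.HodgeTheory.HodgeStructureOfHodgeModelSubHodge
import Literature.AlgebraicGeometry.Motives.HodgeStructureSemisimple
import Literature.AlgebraicGeometry.HodgeTheory.HodgeTypeConjugation
import Summits.HodgeConjecture.HodgeConjecture.Theorems.LinearSystemTorelliTranscendentalOrSupportedStubPerpSubHodge

/-!
# Crux `TranscendentalOrSupported` (stmt-HodgeConjecture-10853), line `Sketch` — stub
# `stub_completelyReducible`: complete reducibility of rationally spanned sub-Hodge subspaces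

Helper file for the line skeleton (v4, isotypic split) of the crux `TranscendentalOrSupported` of
route `LinearSystemTorelli`, registered stub `stub_completelyReducible`. Notation: `X` smooth
projective of dimension `n` over `ℂ`, `A` a Hodge model of `X` (`A.pullback k : Hᵏ(X(ℂ); ℂ) →
Hᵏ(X^an; ℂ)` the bijective comparison, `A.hodgePQ k p q` the piece `H^{p,q}` of the model),
`β = ofRatClassBaseChange : Hᵏ(X(ℂ); ℚ) ⊗ ℂ → Hᵏ(X(ℂ); ℂ)` the complexification of the rational
lattice (an isomorphism for `X` smooth projective), `Θ_A = A^* ∘ β` (`HodgeModel.complexification`).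
A complex subspace `U ⊆ Hᵏ(X(ℂ); ℂ)` is *rationally spanned* if
`U = span ℂ {x ∈ U | IsRationalClass x}`, and *a sub-Hodge structure read in `A`* if
`U.map A^* = ⨆_{p+q=k} U.map A^* ⊓ H^{p,q}`.

CLAIM (`stub_completelyReducible`). Granted the named fact
`smoothProjective_hodgeStructure_isPolarizable` (the weight-`k` Hodge structure
`A.hodgeStructure hX hA k` on `Hᵏ(X(ℂ); ℚ)` is polarizable; Hodge–Riemann, Voisin I Thm. 6.32):
for rationally spanned sub-Hodge subspaces `V ≤ W ⊆ Hᵏ(X(ℂ); ℂ)` there is a rationally spanned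
sub-Hodge subspace `V'` with `V ⊓ V' = ⊥` and `V ⊔ V' = W`.

PROOF (Voisin I, Lemma 7.26; Voisin 2025, Prop. 2.11 — semisimplicity of polarizable Hodge
structures, on the tree's carriers).
* A rationally spanned `U` is `β(K_U ⊗ ℂ)` for its *rational lattice*
  `K_U = {a ∈ Hᵏ(X(ℂ); ℚ) | a ⊗ 1 ∈ U}` (`completelyReducible_exists_ratLattice`,
  `completelyReducible_eq_map_baseChange_ratLattice`), and
  conversely every `β(K ⊗ ℂ)` is rationally spanned (`completelyReducible_span_map_baseChange`).
* `U = β(K ⊗ ℂ)` is a sub-Hodge structure read in `A` iff `K` underlies a sub-Hodge structure of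
  `A.hodgeStructure hX hA k` (`A` is Hodge symmetric, `HodgeModel.isHodgeSymmetric`): "only if" is
  the tree's `HodgeModel.baseChange_eq_iSup_of_map_pullback` with
  `HodgeModel.exists_subHodgeStructure_of_decomposition`; "if"
  (`completelyReducible_isSubHodge_of_subHodgeStructure`) transports
  `SubHodgeStructure.baseChange_le_iSup_inf` (`K ⊗ ℂ ⊆ Σ_p (K ⊗ ℂ) ∩ V^{p,k-p}`) along `Θ_A`, the
  pieces of `A.hodgeStructure` being `Θ_A⁻¹(H^{p,k-p})` (`HodgeModel.piece_eq_ratPiece`) for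
  `0 ≤ p ≤ k` and `0` otherwise (`HodgeModel.ratF_eq_bot`).
* By semisimplicity (`HodgeStructure.SubHodgeStructure.exists_isCompl`, fed with the polarizability;
  `Hᵏ(X(ℂ); ℚ)` is finite-dimensional, `finite_singularCohomology_rat_complexPoints`) the lattice
  `K_V` has a complementary sub-Hodge structure `K''`: `K_V ⊕ K'' = Hᵏ(X(ℂ); ℚ)`. Put
  `V' := β((K'' ⊓ K_W) ⊗ ℂ)`. Base change `ℚ ↝ ℂ` commutes with `⊓` (flatness:
  `completelyReducible_baseChange_inf`) and `⊔` (`completelyReducible_baseChange_sup`), and `β` is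
  injective, so `V ⊓ V' = β((K_V ⊓ K'' ⊓ K_W) ⊗ ℂ) = 0` and, by the modular law (`K_V ≤ K_W`),
  `V ⊔ V' = β(((K_V ⊔ K'') ⊓ K_W) ⊗ ℂ) = β(K_W ⊗ ℂ) = W`; finally `V' = β(K'' ⊗ ℂ) ⊓ W` is a
  sub-Hodge structure read in `A` as an intersection of two such
  (`completelyReducible_isSubHodge_inf`: the Hodge components of a class of a sub-Hodge subspace
  lie in it, `perpSubHodge_component_mem`).

The named fact `smoothProjective_hodgeStructure_isPolarizable` is the hypothesis `hpol` of the
stub (registered shape); no other named fact is taken as a hypothesis and none is introduced.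

References: C. Voisin, *Hodge Theory and Complex Algebraic Geometry I* (CUP 2002), §7.1.1, §7.3.1
(Def. 7.24, Lemma 7.26), Thm. 6.32; C. Voisin, *Hodge and generalized Hodge conjectures, coniveau
and algebraic cycles*, J. Open Math. Probl. 1 (2025), Prop. 2.11; P. Deligne, *Théorie de Hodge
II*, Publ. Math. IHÉS 40 (1971), 1.2.5, 2.1.
-/

-- `Summit.HodgeConjecture.HodgeConjecture.Theorems` is the mandated namespace (single-conjunct summit:
-- Sub = Summit), which `linter.dupNamespace` flags on every declaration; the lakefile turns the
-- linter off tree-wide (weak option), restated here so stand-alone elaboration is warning-free too.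
set_option linter.dupNamespace false

noncomputable section

namespace Summit.HodgeConjecture.HodgeConjecture.Theorems

open scoped TensorProduct
open CategoryTheory
open Literature.AlgebraicGeometry.Motives Literature.AlgebraicGeometry.HodgeTheory
open Literature.AlgebraicTopology.SingularHomology
-- `Finset.antidiagonal` alone resolves to the `Set.IsPWO` antidiagonal of `Data.Finset.MulAntidiagonal`
open Finset.HasAntidiagonal (antidiagonal mem_antidiagonal)

/-! ### Base change `ℚ ↝ ℂ` commutes with `⊔` and `⊓` -/

section BaseChange

variable {M : Type*} [AddCommGroup M] [Module ℚ M]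

/-- **Base change commutes with `⊔`**: `(K₁ + K₂) ⊗ ℂ = K₁ ⊗ ℂ + K₂ ⊗ ℂ` inside `ℂ ⊗_ℚ M`
(`K ⊗ ℂ` is the `ℂ`-span of the `1 ⊗ a`, `a ∈ K`, `Submodule.baseChange_eq_span`). [folklore] -/
theorem completelyReducible_baseChange_sup (K₁ K₂ : Submodule ℚ M) :
    (K₁ ⊔ K₂).baseChange ℂ = K₁.baseChange ℂ ⊔ K₂.baseChange ℂ := by
  refine le_antisymm ?_
    (sup_le (Submodule.baseChange_mono ℂ le_sup_left) (Submodule.baseChange_mono ℂ le_sup_right))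
  rw [Submodule.baseChange_eq_span ℂ (K₁ ⊔ K₂), Submodule.span_le]
  rintro _ ⟨m, hm, rfl⟩
  obtain ⟨a, ha, b, hb, rfl⟩ := Submodule.mem_sup.1 hm
  rw [map_add]
  exact Submodule.add_mem_sup (Submodule.tmul_mem_baseChange_of_mem 1 ha)
    (Submodule.tmul_mem_baseChange_of_mem 1 hb)

/-- **Base change commutes with `⊓`**: `(K₁ ∩ K₂) ⊗ ℂ = (K₁ ⊗ ℂ) ∩ (K₂ ⊗ ℂ)` inside `ℂ ⊗_ℚ M`
(`ℂ` is flat over `ℚ`): `K₁ ∩ K₂ = ι₁(ker(π₂ ∘ ι₁))` for `ι₁ : K₁ ↪ M`, `π₂ : M ↠ M ⧸ K₂`, base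
change commutes with kernels (`HodgeStructure.mem_baseChange_ker_iff`) and images
(`HodgeStructure.baseChange_map`), and `K₂ ⊗ ℂ = ker (π₂ ⊗ ℂ)`. [folklore] -/
theorem completelyReducible_baseChange_inf (K₁ K₂ : Submodule ℚ M) :
    (K₁ ⊓ K₂).baseChange ℂ = K₁.baseChange ℂ ⊓ K₂.baseChange ℂ := by
  refine le_antisymm (le_inf (Submodule.baseChange_mono ℂ inf_le_left)
    (Submodule.baseChange_mono ℂ inf_le_right)) ?_
  rintro x ⟨⟨t, rfl⟩, hx₂⟩
  -- `K₁ ⊓ K₂ = ι₁ (ker (π₂ ∘ ι₁))`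
  have hg : (LinearMap.ker (K₂.mkQ ∘ₗ K₁.subtype)).map K₁.subtype = K₁ ⊓ K₂ := by
    rw [LinearMap.ker_comp, Submodule.ker_mkQ, Submodule.map_comap_subtype]
  -- `x = (ι₁ ⊗ ℂ) t ∈ K₂ ⊗ ℂ = ker (π₂ ⊗ ℂ)`, so `t ∈ ker ((π₂ ∘ ι₁) ⊗ ℂ) = ker (π₂ ∘ ι₁) ⊗ ℂ`
  have hx₂' : (K₂.mkQ).baseChange ℂ (K₁.subtype.baseChange ℂ t) = 0 := by
    rw [← HodgeStructure.mem_baseChange_ker_iff, Submodule.ker_mkQ]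
    exact hx₂
  have ht : t ∈ (LinearMap.ker (K₂.mkQ ∘ₗ K₁.subtype)).baseChange ℂ := by
    rw [HodgeStructure.mem_baseChange_ker_iff, LinearMap.baseChange_comp, LinearMap.comp_apply]
    exact hx₂'
  rw [← hg, HodgeStructure.baseChange_map]
  exact Submodule.mem_map_of_mem ht

end BaseChange

/-! ### Rational lattices of complex subspaces of `Hᵏ(X(ℂ); ℂ)` -/

section RatLattice

variable {n : ℕ} {X : SchemeOver ℂ}

/-- **Rational lattices exist**: for a complex subspace `U ⊆ Hᵏ(X(ℂ); ℂ)` there is a `ℚ`-subspace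
`K_U ⊆ Hᵏ(X(ℂ); ℚ)` with `a ∈ K_U ↔ a ⊗ 1 ∈ U` — the preimage of `U` under `β ∘ (1 ⊗ –)`,
`β = ofRatClassBaseChange` (no `Module ℚ` instance on `Hᵏ(X(ℂ); ℂ)` is needed).
[cite: VoisinHodgeI2002, §7.1.1] -/
theorem completelyReducible_exists_ratLattice (k : ℕ) (U : Submodule ℂ (complexBetti X k)) :
    ∃ K : Submodule ℚ (bettiCohomology X k), ∀ a, a ∈ K ↔ ofRatClass (ComplexPoints X) k a ∈ U :=
  ⟨((U.comap (ofRatClassBaseChange (ComplexPoints X) k)).restrictScalars ℚ).comap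
    HodgeStructure.ofRat, fun a ↦ by
      rw [Submodule.mem_comap, Submodule.restrictScalars_mem, Submodule.mem_comap,
        ofRatClassBaseChange_ofRat]⟩

/-- **`β(K ⊗ ℂ)` is spanned by its rational classes** for every `ℚ`-subspace `K ⊆ Hᵏ(X(ℂ); ℚ)`:
it is the `ℂ`-span of the rational classes `β(1 ⊗ a) = a ⊗ 1`, `a ∈ K`
(`Submodule.baseChange_eq_span`). [cite: VoisinHodgeI2002, §7.1.1] -/
theorem completelyReducible_span_map_baseChange (k : ℕ) (K : Submodule ℚ (bettiCohomology X k)) :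
    Submodule.span ℂ {x : complexBetti X k |
        x ∈ (K.baseChange ℂ).map (ofRatClassBaseChange (ComplexPoints X) k) ∧ IsRationalClass x} =
      (K.baseChange ℂ).map (ofRatClassBaseChange (ComplexPoints X) k) := by
  refine le_antisymm (Submodule.span_le.2 fun x hx ↦ hx.1) ?_
  rw [Submodule.map_le_iff_le_comap, Submodule.baseChange_eq_span, Submodule.span_le]
  rintro _ ⟨a, ha, rfl⟩
  rw [SetLike.mem_coe, Submodule.mem_comap, TensorProduct.mk_apply, ofRatClassBaseChange_tmul,
    one_smul]
  refine Submodule.subset_span ⟨?_, isRationalClass_ofRatClass a⟩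
  refine ⟨(1 : ℂ) ⊗ₜ a, Submodule.subset_span ⟨a, ha, rfl⟩, ?_⟩
  rw [ofRatClassBaseChange_tmul, one_smul]

/-- **A rationally spanned subspace is the complexification of its rational lattice**:
if `U = span ℂ {x ∈ U | IsRationalClass x}` and `K_U = {a | a ⊗ 1 ∈ U}` then `U = β(K_U ⊗ ℂ)`
(every rational class is `a ⊗ 1 = β(1 ⊗ a)`, `isRationalClass_iff_mem_range_ofRatClass`).
[cite: VoisinHodgeI2002, §7.1.1] -/
theorem completelyReducible_eq_map_baseChange_ratLattice {k : ℕ}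
    {U : Submodule ℂ (complexBetti X k)}
    (hU : Submodule.span ℂ {x : complexBetti X k | x ∈ U ∧ IsRationalClass x} = U)
    {K : Submodule ℚ (bettiCohomology X k)}
    (hK : ∀ a, a ∈ K ↔ ofRatClass (ComplexPoints X) k a ∈ U) :
    U = (K.baseChange ℂ).map (ofRatClassBaseChange (ComplexPoints X) k) := by
  refine le_antisymm ?_ ?_
  · calc U = Submodule.span ℂ {x : complexBetti X k | x ∈ U ∧ IsRationalClass x} := hU.symm
      _ ≤ _ := by
        rw [Submodule.span_le]
        rintro x ⟨hxU, hxrat⟩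
        obtain ⟨a, rfl⟩ := (isRationalClass_iff_mem_range_ofRatClass x).1 hxrat
        refine ⟨(1 : ℂ) ⊗ₜ a, Submodule.tmul_mem_baseChange_of_mem 1 ((hK a).2 hxU), ?_⟩
        rw [ofRatClassBaseChange_tmul, one_smul]
  · rw [Submodule.baseChange_eq_span, Submodule.map_span, Submodule.span_le]
    rintro _ ⟨_, ⟨a, ha, rfl⟩, rfl⟩
    rw [SetLike.mem_coe, TensorProduct.mk_apply, ofRatClassBaseChange_tmul, one_smul]
    exact (hK a).1 ha

end RatLattice

/-! ### Sub-Hodge structures of `A.hodgeStructure` versus sub-Hodge subspaces read in `A` -/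

section SubHodge

variable {n : ℕ} {X : SchemeOver ℂ}

/-- **A sub-Hodge structure complexifies to a sub-Hodge subspace read in the model** (the converse
of `HodgeModel.baseChange_eq_iSup_of_map_pullback`): for a sub-Hodge structure `S` of
`A.hodgeStructure hX hA k` with underlying `ℚ`-subspace `K`, the subspace `β(K ⊗ ℂ)` pulled back
to `A` is the supremum of its intersections with the `H^{p,q}`, `p + q = k`. Indeed
`K ⊗ ℂ ⊆ Σ_{p ∈ ℤ} (K ⊗ ℂ) ∩ V^{p,k-p}` (`SubHodgeStructure.baseChange_le_iSup_inf`, Voisin I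
Def. 7.24), where `V^{p,k-p} = Θ_A⁻¹(H^{p,k-p})` for `0 ≤ p ≤ k`
(`HodgeModel.piece_eq_ratPiece`) and `V^{p,k-p} = F^p ∩ conj F^{k-p} = 0` otherwise
(`HodgeModel.ratF_eq_bot`); apply the isomorphism `Θ_A = A^* ∘ β`.
[cite: VoisinHodgeI2002, §7.3.1 Def. 7.24 and §7.1.1] -/
theorem completelyReducible_isSubHodge_of_subHodgeStructure (hX : IsSmoothProjective n X)
    (A : HodgeModel n X) (hA : A.IsHodgeSymmetric) (k : ℕ)
    (S : (A.hodgeStructure hX hA k).SubHodgeStructure) :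
    ((S.toSubmodule.baseChange ℂ).map (ofRatClassBaseChange (ComplexPoints X) k)).map
        (A.pullback k).hom =
      ⨆ (p : ℕ) (q : ℕ) (_ : p + q = k),
        ((S.toSubmodule.baseChange ℂ).map (ofRatClassBaseChange (ComplexPoints X) k)).map
          (A.pullback k).hom ⊓ A.hodgePQ k p q := by
  -- `map A^* ∘ map β = map Θ_A`
  have hΘ : ((S.toSubmodule.baseChange ℂ).map (ofRatClassBaseChange (ComplexPoints X) k)).map
      (A.pullback k).hom =
        (S.toSubmodule.baseChange ℂ).map (A.complexification hX k).toLinearMap := by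
    rw [← Submodule.map_comp]
    rfl
  rw [hΘ]
  refine le_antisymm ?_ (iSup_le fun _ ↦ iSup_le fun _ ↦ iSup_le fun _ ↦ inf_le_left)
  rintro _ ⟨x, hx, rfl⟩
  have hx' := S.baseChange_le_iSup_inf hx
  clear hx
  induction hx' using Submodule.iSup_induction' with
  | mem p y hy =>
    obtain ⟨hyK, hyp⟩ := Submodule.mem_inf.1 hy
    by_cases hp : 0 ≤ p ∧ p ≤ (k : ℤ)
    · -- `V^{p,k-p} = Θ_A⁻¹(H^{p,k-p})`
      obtain ⟨p', rfl⟩ := Int.eq_ofNat_of_zero_le hp.1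
      obtain ⟨q', hpq⟩ : ∃ q' : ℕ, p' + q' = k := ⟨k - p', by omega⟩
      have e : (A.hodgeStructure hX hA k).piece (p' : ℤ) ((k : ℤ) - p') =
          A.ratPiece hX k p' q' := by
        rw [← A.piece_eq_ratPiece hX hA hpq]
        congr 1
        omega
      rw [e, HodgeModel.mem_ratPiece_iff] at hyp
      exact Submodule.mem_iSup_of_mem p' (Submodule.mem_iSup_of_mem q'
        (Submodule.mem_iSup_of_mem hpq ⟨Submodule.mem_map_of_mem hyK, hyp⟩))
    · -- `V^{p,k-p} = 0`
      have e : (A.hodgeStructure hX hA k).piece p ((k : ℤ) - p) = ⊥ := by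
        rw [HodgeStructure.piece_of_add_eq _ (by omega), HodgeModel.hodgeStructure_F,
          HodgeModel.hodgeStructure_F]
        rcases not_and_or.1 hp with h | h
        · rw [A.ratF_eq_bot hX k (show ((k : ℕ) : ℤ) < (k : ℤ) - p by omega),
            HodgeStructure.complexConj_bot, inf_bot_eq]
        · rw [A.ratF_eq_bot hX k (show ((k : ℕ) : ℤ) < p by omega), bot_inf_eq]
      rw [e, Submodule.mem_bot] at hyp
      rw [hyp, map_zero]
      exact Submodule.zero_mem _
  | zero => rw [map_zero]; exact Submodule.zero_mem _
  | add y z _ _ hy hz => rw [map_add]; exact Submodule.add_mem _ hy hz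

/-- **The intersection of two sub-Hodge subspaces read in `A` is one**: if `U₁.map A^*` and
`U₂.map A^*` are the suprema of their intersections with the `H^{p,q}`, so is `(U₁ ⊓ U₂).map A^*` —
the Hodge components of `x ∈ U₁ ⊓ U₂` (`HodgeModel.exists_sum_eq_of_hodgeDecomposition`) lie in
`U₁` and in `U₂` (`perpSubHodge_component_mem`: the decomposition into types is unique).
[cite: VoisinHodgeI2002, §7.3.1 (remark after Lemma 7.26)] -/
theorem completelyReducible_isSubHodge_inf (A : HodgeModel n X) {k : ℕ}
    {U₁ U₂ : Submodule ℂ (complexBetti X k)}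
    (h₁ : U₁.map (A.pullback k).hom =
      ⨆ (p : ℕ) (q : ℕ) (_ : p + q = k), U₁.map (A.pullback k).hom ⊓ A.hodgePQ k p q)
    (h₂ : U₂.map (A.pullback k).hom =
      ⨆ (p : ℕ) (q : ℕ) (_ : p + q = k), U₂.map (A.pullback k).hom ⊓ A.hodgePQ k p q) :
    (U₁ ⊓ U₂).map (A.pullback k).hom =
      ⨆ (p : ℕ) (q : ℕ) (_ : p + q = k), (U₁ ⊓ U₂).map (A.pullback k).hom ⊓ A.hodgePQ k p q := by
  refine le_antisymm ?_ (iSup_le fun _ ↦ iSup_le fun _ ↦ iSup_le fun _ ↦ inf_le_left)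
  rintro _ ⟨x, ⟨hx₁, hx₂⟩, rfl⟩
  -- the Hodge components of `x` lie in `U₁` and in `U₂`
  obtain ⟨z, hz, hzt⟩ := A.exists_sum_eq_of_hodgeDecomposition k x
  have hz₁ := perpSubHodge_component_mem A h₁ hx₁ hz hzt
  have hz₂ := perpSubHodge_component_mem A h₂ hx₂ hz hzt
  have hxsum : (A.pullback k).hom x = ∑ i ∈ antidiagonal k, (A.pullback k).hom (z i) := by
    rw [← map_sum, hz]
  rw [hxsum]
  refine Submodule.sum_mem _ fun i hi ↦ ?_
  exact Submodule.mem_iSup_of_mem i.1 (Submodule.mem_iSup_of_mem i.2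
    (Submodule.mem_iSup_of_mem (mem_antidiagonal.1 hi)
      ⟨Submodule.mem_map_of_mem ⟨hz₁ i hi, hz₂ i hi⟩, hzt i hi⟩))

end SubHodge

/-! ### The stub -/

/-- **STUB `stub_completelyReducible` (complete reducibility) of the crux
`TranscendentalOrSupported`, line `Sketch`.** Granted the polarizability of the Hodge structure
on `Hᵏ(X(ℂ); ℚ)` (`smoothProjective_hodgeStructure_isPolarizable`, Hodge–Riemann): for `X` smooth
projective of dimension `n`, a Hodge model `A`, a degree `k`, and rationally spanned subspaces
`V ≤ W ⊆ Hᵏ(X(ℂ); ℂ)` whose pull-backs to `A` are sub-Hodge structures, there is a rationally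
spanned `V'`, again a sub-Hodge structure read in `A`, with `V ⊓ V' = ⊥` and `V ⊔ V' = W`.
Proof: `V = β(K_V ⊗ ℂ)`, `W = β(K_W ⊗ ℂ)` for the rational lattices `K_V ≤ K_W`
(`completelyReducible_eq_map_baseChange_ratLattice`); `K_V` underlies a sub-Hodge structure of
`A.hodgeStructure hX hA k` (`A` is Hodge symmetric, `HodgeModel.isHodgeSymmetric`;
`HodgeModel.baseChange_eq_iSup_of_map_pullback`,
`HodgeModel.exists_subHodgeStructure_of_decomposition`), which by semisimplicity
(`HodgeStructure.SubHodgeStructure.exists_isCompl`; `Hᵏ(X(ℂ); ℚ)` is finite-dimensional,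
`finite_singularCohomology_rat_complexPoints`) has a complementary sub-Hodge structure `K''`; then
`V' := β((K'' ⊓ K_W) ⊗ ℂ)` is rationally spanned (`completelyReducible_span_map_baseChange`),
equals `β(K'' ⊗ ℂ) ⊓ W` (base change and the injective `β` commute with `⊓`), hence is a
sub-Hodge subspace read in `A` (`completelyReducible_isSubHodge_of_subHodgeStructure`,
`completelyReducible_isSubHodge_inf`), and `V ⊓ V' = ⊥`, `V ⊔ V' = W` by `K_V ⊓ K'' = 0`,
`K_V + K'' = Hᵏ(X(ℂ); ℚ)` and the modular law. [cite: VoisinHodgeI2002, Lemma 7.26]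
[cite: Voisin2025, Prop. 2.11] -/
theorem stub_completelyReducible (hpol : smoothProjective_hodgeStructure_isPolarizable) :
    ∀ ⦃n : ℕ⦄ ⦃X : SchemeOver ℂ⦄ (hX : IsSmoothProjective n X) (A : HodgeModel n X) (k : ℕ)
    (V W : Submodule ℂ (complexBetti X k)),
    Submodule.span ℂ {x : complexBetti X k | x ∈ W ∧ IsRationalClass x} = W →
    W.map (A.pullback k).hom =
      ⨆ (p' : ℕ) (q' : ℕ) (_ : p' + q' = k), W.map (A.pullback k).hom ⊓ A.hodgePQ k p' q' →
    Submodule.span ℂ {x : complexBetti X k | x ∈ V ∧ IsRationalClass x} = V →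
    V.map (A.pullback k).hom =
      ⨆ (p' : ℕ) (q' : ℕ) (_ : p' + q' = k), V.map (A.pullback k).hom ⊓ A.hodgePQ k p' q' →
    V ≤ W →
    ∃ V' : Submodule ℂ (complexBetti X k),
      Submodule.span ℂ {x : complexBetti X k | x ∈ V' ∧ IsRationalClass x} = V' ∧
      V'.map (A.pullback k).hom =
        ⨆ (p' : ℕ) (q' : ℕ) (_ : p' + q' = k), V'.map (A.pullback k).hom ⊓ A.hodgePQ k p' q' ∧
      V ⊓ V' = ⊥ ∧ V ⊔ V' = W := by
  intro n X hX A k V W hWrat hWsub hVrat hVsub hVW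
  haveI := finite_singularCohomology_rat_complexPoints hX k
  have hA : A.IsHodgeSymmetric := A.isHodgeSymmetric hX
  -- `V`, `W` are the complexifications of their rational lattices `K_V ≤ K_W`
  obtain ⟨KV, hKV⟩ := completelyReducible_exists_ratLattice k V
  obtain ⟨KW, hKW⟩ := completelyReducible_exists_ratLattice k W
  have hVeq := completelyReducible_eq_map_baseChange_ratLattice hVrat hKV
  have hWeq := completelyReducible_eq_map_baseChange_ratLattice hWrat hKW
  have hKVW : KV ≤ KW := fun a ha ↦ (hKW a).2 (hVW ((hKV a).1 ha))
  -- `K_V` underlies a sub-Hodge structure of `A.hodgeStructure hX hA k`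
  obtain ⟨S, hS⟩ := A.exists_subHodgeStructure_of_decomposition hX hA k KV
    (A.baseChange_eq_iSup_of_map_pullback hX k _ (by rw [← hVeq]; exact hVsub))
  -- semisimplicity: a complementary sub-Hodge structure `K''`
  obtain ⟨S', hc⟩ := S.exists_isCompl (hpol hX A hA k)
  rw [hS] at hc
  refine ⟨((S'.toSubmodule ⊓ KW).baseChange ℂ).map (ofRatClassBaseChange (ComplexPoints X) k),
    completelyReducible_span_map_baseChange k _, ?_, ?_, ?_⟩
  · -- `V' = β(K'' ⊗ ℂ) ⊓ W` is a sub-Hodge subspace read in `A`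
    rw [completelyReducible_baseChange_inf,
      Submodule.map_inf _ (ofRatClassBaseChange_injective _ k), ← hWeq]
    exact completelyReducible_isSubHodge_inf A
      (completelyReducible_isSubHodge_of_subHodgeStructure hX A hA k S') hWsub
  · -- `V ⊓ V' = ⊥`
    have h0 : KV ⊓ (S'.toSubmodule ⊓ KW) = ⊥ := disjoint_iff.1 (hc.disjoint.mono_right inf_le_left)
    rw [hVeq, ← Submodule.map_inf _ (ofRatClassBaseChange_injective _ k),
      ← completelyReducible_baseChange_inf, h0, Submodule.baseChange_bot, Submodule.map_bot]
  · -- `V ⊔ V' = W` (modular law)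
    have h1 : KV ⊔ (S'.toSubmodule ⊓ KW) = KW := by
      rw [← sup_inf_assoc_of_le _ hKVW, hc.sup_eq_top, top_inf_eq]
    rw [hVeq, ← Submodule.map_sup, ← completelyReducible_baseChange_sup, h1, ← hWeq]

end Summit.HodgeConjecture.HodgeConjecture.Theorems

end
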